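import Mathlib

/-!
# `IsometryMove`, line `bruhat-inversion-chain`: the small Bruhat cell `c = 0`

Stub `stub_affineCase` of the crux `IsometryMove` (stmt-KontsevichZagierPeriods-3471, route
HyperbolicBloch). In the upper half-space `ℝ³` (coordinates `p 0 = x`, `p 1 = y`, `p 2 = t`)
write `w = p 0 + i·ε·p 1` and `N = |c·w + d|² + |c|²·t²`. The typed Poincaré extension of the
Möbius map `w ↦ (a·w + b)/(c·w + d)` is

`g p = ( ((a·w + b)·conj(c·w + d) + a·c̄·t²).re / N, ((a·w + b)·conj(c·w + d) + a·c̄·t²).im / N,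
  ‖a·d − b·c‖·t / N )`.

On the small Bruhat cell `c = 0` (hence `d ≠ 0`) this is the single boundary-fixing similarity
`S(a/d, b/d, ε) : p ↦ (((a/d)·w + b/d).re, ((a/d)·w + b/d).im, ‖a/d‖·t)`.

The proof is pure algebra: with `c = 0` the numerator is `(a·w + b)·d̄` (`affine_numerator`) and
`N = |d|²` (`affine_denominator`); then `(a·w + b)·d̄ / |d|² = (a/d)·w + b/d` because
`|d|² = d·d̄` (`affine_moebius`), and the heights agree because `‖a·d‖/|d|² = ‖a/d‖`
(`affine_height`).

References: R. Benedetti, C. Petronio, *Lectures on Hyperbolic Geometry* (1992), proof of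
Prop. A.3.5(2) ("if `c = 0` obvious").
-/

noncomputable section

namespace Summit.KontsevichZagierPeriods.HyperbolicBloch.IsometryMove

/-- With `c = 0` the numerator `(a·w + b)·conj(c·w + d) + a·c̄·t²` of the Poincaré extension is
`(a·w + b)·d̄`. [folklore] -/
theorem affine_numerator (a b d w : ℂ) (t : ℝ) :
    (a * w + b) * (starRingEnd ℂ) (0 * w + d) + a * (starRingEnd ℂ) 0 * (t : ℂ) ^ 2 =
      (a * w + b) * (starRingEnd ℂ) d := by
  rw [zero_mul, zero_add, map_zero, mul_zero, zero_mul, add_zero]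

/-- With `c = 0` the denominator `N = |c·w + d|² + |c|²·t²` of the Poincaré extension is `|d|²`.
[folklore] -/
theorem affine_denominator (d w : ℂ) (t : ℝ) :
    Complex.normSq (0 * w + d) + Complex.normSq 0 * t ^ 2 = Complex.normSq d := by
  rw [zero_mul, zero_add, map_zero, zero_mul, add_zero]

/-- The affine Möbius identity read through `|d|² = d·d̄`: for `d ≠ 0`,
`(a·w + b)·d̄ / |d|² = (a/d)·w + b/d`. [folklore] -/
theorem affine_moebius (a b w : ℂ) {d : ℂ} (hd : d ≠ 0) :
    (a * w + b) * (starRingEnd ℂ) d / ((Complex.normSq d : ℝ) : ℂ) = a / d * w + b / d := by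
  have hd' : (starRingEnd ℂ) d ≠ 0 := (map_ne_zero (starRingEnd ℂ)).mpr hd
  rw [← Complex.mul_conj, mul_div_mul_right _ _ hd', add_div, mul_div_right_comm]

/-- The heights agree on the small cell: `‖a·d − b·0‖·t / |d|² = ‖a/d‖·t` for `d ≠ 0`.
[folklore] -/
theorem affine_height (a b : ℂ) {d : ℂ} (hd : d ≠ 0) (t : ℝ) :
    ‖a * d - b * 0‖ * t / Complex.normSq d = ‖a / d‖ * t := by
  have hd' : ‖d‖ ≠ 0 := norm_ne_zero_iff.mpr hd
  rw [mul_zero, sub_zero, norm_mul, norm_div, Complex.normSq_eq_norm_sq]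
  field_simp

/-- **Small cell, pointwise form in the variables `w = p 0 + iε·p 1`, `t = p 2`.** For `c = 0` and
`d ≠ 0` the typed Poincaré extension `g` (with `c = 0` substituted) equals the similarity
`S(a/d, b/d, ε)` written out. [cite: BenedettiPetronio1992, A.3.5] -/
theorem affine_pointwise (a b w : ℂ) {d : ℂ} (hd : d ≠ 0) (t : ℝ) :
    (![((a * w + b) * (starRingEnd ℂ) (0 * w + d) + a * (starRingEnd ℂ) 0 * (t : ℂ) ^ 2).re /
        (Complex.normSq (0 * w + d) + Complex.normSq 0 * t ^ 2),
      ((a * w + b) * (starRingEnd ℂ) (0 * w + d) + a * (starRingEnd ℂ) 0 * (t : ℂ) ^ 2).im /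
        (Complex.normSq (0 * w + d) + Complex.normSq 0 * t ^ 2),
      ‖a * d - b * 0‖ * t / (Complex.normSq (0 * w + d) + Complex.normSq 0 * t ^ 2)] : Fin 3 → ℝ) =
    ![(a / d * w + b / d).re, (a / d * w + b / d).im, ‖a / d‖ * t] := by
  rw [affine_numerator, affine_denominator, ← affine_moebius a b w hd, Complex.div_ofReal_re,
    Complex.div_ofReal_im, affine_height a b hd]

/-- **Small Bruhat cell `c = 0`** (stub `stub_affineCase` of line `bruhat-inversion-chain`). For
`c = 0` (so `d ≠ 0`, since `a·d − b·c ≠ 0` upstream) the typed Poincaré extension of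
`w ↦ (a·w + b)/(c·w + d)` is the single boundary-fixing similarity `S(a/d, b/d, ε)`.
[cite: BenedettiPetronio1992, A.3.5] -/
theorem stub_affineCase : ∀ (a b c d : ℂ) (ε : ℝ), c = 0 → d ≠ 0 → ∀ (S : (Fin 3 → ℝ) → (Fin 3 → ℝ)), (∀ p, S p = ![((a / d) * (Complex.mk (p 0) (ε * p 1)) + b / d).re, ((a / d) * (Complex.mk (p 0) (ε * p 1)) + b / d).im, ‖a / d‖ * p 2]) → ∀ (p : Fin 3 → ℝ), (![((a * (Complex.mk (p 0) (ε * p 1)) + b) * (starRingEnd ℂ) (c * (Complex.mk (p 0) (ε * p 1)) + d) + a * (starRingEnd ℂ) c * (p 2 : ℂ) ^ 2).re / (Complex.normSq (c * (Complex.mk (p 0) (ε * p 1)) + d) + Complex.normSq c * p 2 ^ 2), ((a * (Complex.mk (p 0) (ε * p 1)) + b) * (starRingEnd ℂ) (c * (Complex.mk (p 0) (ε * p 1)) + d) + a * (starRingEnd ℂ) c * (p 2 : ℂ) ^ 2).im / (Complex.normSq (c * (Complex.mk (p 0) (ε * p 1)) + d) + Complex.normSq c * p 2 ^ 2), ‖a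 * d - b * c‖ * p 2 / (Complex.normSq (c * (Complex.mk (p 0) (ε * p 1)) + d) + Complex.normSq c * p 2 ^ 2)] : Fin 3 → ℝ) = S p := by
  intro a b c d ε hc hd S hS p
  subst hc
  rw [hS]
  exact affine_pointwise a b _ hd (p 2)

end Summit.KontsevichZagierPeriods.HyperbolicBloch.IsometryMove

end
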